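import Summits.BirchSwinnertonDyer.BirchSwinnertonDyer.Theorems.GenusKolyvaginAtTwoGenusPrimitiveSupplyAtTwoTwistingPrimeLevelFourClassFrobenius
import HarnessLib

/-!
# Route `GenusKolyvaginAtTwo`, crux #2 `GenusPrimitiveSupplyAtTwo` (stmt-BirchSwinnertonDyer-22136):
# VALUES OF THE LEVEL-`4` CLASS ON `Γ_{ℚ(E[2])}` (kernel `𝔽₄ ⊂ M₂(𝔽₂)`), and the basis-free strictness criterion
# **`[ξ_W, σ] ∈ (σ − 1)E[2] ⟺ σ² = ±1 on E[4]`** at a transposition-type `σ`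

Width seat `bsd-line-gk2-p4` g10, cell `bsd-f1-sign2`; helper (`--supports stmt-BirchSwinnertonDyer-22136`), §54 of the twisting-prime
series (after `…LevelFourClassFrobenius` §52). THEOREMS ONLY: no definition, no named fact, no `sorry`; no item is closed; BSD is not proved.

* §54a (finite computation, completing g8's §23): a NON-ZERO equivariant additive `G : M₂(𝔽₂) → 𝔽₂²` has `G(M) = 0 ⟺ M ∈ 𝔽₄`
  (`M = 0 ∨ M³ = 1`, `twoByTwo_equivariant_apply_eq_zero_iff`); `ω, ω²` commute with no transvection (`twoByTwo_eq_one_of_cube_of_commute`).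
* §54b `h1Eval_eq_zero_iff_of_smul_eq_add`: for `ρ̄_{W,2}`, `ρ_{W,4}` onto and `x ≠ 0` dying on `Γ_{ℚ(E[4])}` (THE level-`4` class, §51 +
  g8), and `ρ ∈ Γ_{ℚ(E[2])}` acting on `E[4]` as `u_A : P ↦ P + A(2P)`: **`[x, ρ] = 0 ⟺ A = 0 ∨ A³ = 1`** (`ρ` acts on `E[4]` trivially,
  as `−1`, or through the non-split torus); g8's transfer of `[x, ·]` to an equivariant `F_x : M₂(𝔽₂) → 𝔽₂²` + §54a.
* §54c **`exists_h1Eval_eq_smul_sub_iff_sq_smul`**: same `x`; `σ ∈ Γ_ℚ` moving `E[2]` with `σ² ∈ Γ_{ℚ(E[2])}` (a transposition on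
  `E[2]`): **`[x, σ]` is a coboundary value `σm − m` ⟺ `σ²` acts on `E[4]` as `+1` or as `−1`** (§52a: ⟺ `[x, σ²] = 0`; §54b: ⟺ datum
  `A ∈ 𝔽₄`; `A` commutes with the transposition `σ̄` (`σ` centralises `σ²`), which excludes `ω, ω²`). With §52b this is the exact
  Frobenius condition for the strictness of `ξ_W` at a good prime `ℓ₀` whose Frobenius is a transposition on `E[2]`: `Frob² = ±1` on
  `E[4]` (for `ℓ₀ ≡ 3 (4)`, `det = −1` on `E[4]` rules out `−1`: residue degree `2` in `ℚ(E[4])`).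

References: [LawsonWuthrich2016] §3 (Lemma 6, Thm. 1); [GrossLMS1991] §9 Prop. 9.1, 9.6; [Serre1972] §2.1.
-/

set_option linter.dupNamespace false -- tree convention: `Summit.BirchSwinnertonDyer.BirchSwinnertonDyer.Theorems` (summit = sub-problem)
set_option autoImplicit false

noncomputable section

open scoped Classical Pointwise

namespace Summit.BirchSwinnertonDyer.BirchSwinnertonDyer.Theorems.GenusKolyTwistingPrime

open WeierstrassCurve NumberField IsDedekindDomain Field
open Literature.NumberTheory.GaloisRepresentations Literature.NumberTheory.EllipticCurves
open Literature.NumberTheory Matrix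

/-! ## §54a The kernel of the non-zero equivariant map `M₂(𝔽₂) → 𝔽₂²` is `𝔽₄` -/

section TwoByTwo

/-- **The kernel of a NON-ZERO `GL₂(𝔽₂)`-equivariant additive `G : M₂(𝔽₂) → 𝔽₂²` is `{0, 1, ω, ω²} = 𝔽₄`** (`M = 0 ∨ M³ = 1`): `G` is
the unique non-zero such map (g8 `twoByTwo_equivariant_unique`), namely `M ↦ (tr M + M₀₁, tr M + M₁₀)`, whose kernel is read off.
[cite: LawsonWuthrich2016, §3 (Lemma 6 and the case p = 2)] -/
theorem twoByTwo_equivariant_apply_eq_zero_iff (G : Matrix (Fin 2) (Fin 2) (ZMod 2) →+ (Fin 2 → ZMod 2))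
    (hG : ∀ (g g' : Matrix (Fin 2) (Fin 2) (ZMod 2)) (M : Matrix (Fin 2) (Fin 2) (ZMod 2)), g * g' = 1 → G (g * M * g') = g *ᵥ G M)
    (h0 : G ≠ 0) (M : Matrix (Fin 2) (Fin 2) (ZMod 2)) : G M = 0 ↔ M = 0 ∨ M * M * M = 1 := by
  let u : Matrix (Fin 2) (Fin 2) (ZMod 2) →+ (Fin 2 → ZMod 2) :=
    { toFun := fun N ↦ ![N 0 0 + N 1 1 + N 0 1, N 0 0 + N 1 1 + N 1 0]
      map_zero' := by decide
      map_add' := fun N N' ↦ by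
        ext i
        fin_cases i <;> simp [Matrix.add_apply] <;> ring }
  have hu_apply : ∀ N : Matrix (Fin 2) (Fin 2) (ZMod 2), u N = ![N 0 0 + N 1 1 + N 0 1, N 0 0 + N 1 1 + N 1 0] := fun _ ↦ rfl
  have hu : ∀ (g g' : Matrix (Fin 2) (Fin 2) (ZMod 2)) (N : Matrix (Fin 2) (Fin 2) (ZMod 2)), g * g' = 1 → u (g * N * g') = g *ᵥ u N := by
    intro g g' N hgg'
    rw [hu_apply, hu_apply]
    revert g g' N
    decide
  have hu0 : u ≠ 0 := by
    intro h
    have h1 := DFunLike.congr_fun h (Matrix.single 0 0 1)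
    rw [hu_apply, AddMonoidHom.zero_apply] at h1
    revert h1
    decide
  have hGu : G = u := twoByTwo_equivariant_unique G u hG hu h0 hu0
  rw [hGu, hu_apply]
  revert M
  decide

/-- **An element of `𝔽₄ ∖ 𝔽₂` commutes with no transvection**: `M³ = 1`, `S² = 1 ≠ S`, `SM = MS` force `M = 1` (the centraliser of
`ω` in `M₂(𝔽₂)` is `𝔽₄`, which contains no involution `≠ 1`). [folklore] -/
theorem twoByTwo_eq_one_of_cube_of_commute :
    ∀ (M S : Matrix (Fin 2) (Fin 2) (ZMod 2)), M * M * M = 1 → S * S = 1 → S ≠ 1 → S * M = M * S → M = 1 := by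
  decide

end TwoByTwo

/-! ## §54b Values of the level-`4` class on `Γ_{ℚ(E[2])}` -/

section Values

variable (W : WeierstrassCurve ℚ)

/-- **VALUES OF THE LEVEL-`4` CLASS ON `Γ_{ℚ(E[2])}`.** `W/ℚ` elliptic with `ρ̄_{W,2}` and `ρ_{W,4}` onto; `x ≠ 0` in `H¹(ℚ, E[2])` dying
on `Γ_{ℚ(E[4])}` (the level-`4` class); `ρ ∈ Γ_ℚ` acting on `E[4]` as `u_A : P ↦ P + A(2P)` (so `ρ ∈ Γ_{ℚ(E[2])}`, datum `A`). Then
**`[x, ρ] = 0 ⟺ A = 0 ∨ A³ = 1`** — the kernel of `[x, ·]` on `Γ_{ℚ(E[2])}/Γ_{ℚ(E[4])} ≅ M₂(𝔽₂)` is `𝔽₄ = {0, 1, ω, ω²}`: `ρ` fixes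
`E[4]`, or is `−1` on `E[4]`, or permutes `E[2] ∖ 0` cyclically at level `4`. Proof: g8's transfer (`[x, ρ] = [x, σ_A]`, the equivariant
non-zero `F_x : M ↦ e[x, σ_{endo M}]`) and §54a. [cite: LawsonWuthrich2016, §3] [cite: GrossLMS1991, §9 Prop. 9.1] -/
theorem h1Eval_eq_zero_iff_of_smul_eq_add [W.IsElliptic] (hsurj : W.HasSurjectiveModNGaloisRep 2)
    (hsurj4 : W.HasSurjectiveModNGaloisRep 4) {x : galH1Torsion W (2 : ℤ)} (hx0 : x ≠ 0)
    (hx : ∀ h ∈ torsionFixing W (4 : ℤ), h1Eval W (2 : ℤ) x h = 0)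
    {ρ : absoluteGaloisGroup ℚ} {A : geomTorsion W (2 : ℤ) →+ geomTorsion W (2 : ℤ)}
    (hρ : ∀ P : geomTorsion W (4 : ℤ), ((ρ • P : geomTorsion W (4 : ℤ)) : geomPoints W) =
      (P : geomPoints W) + (A ⟨(2 : ℤ) • (P : geomPoints W), two_zsmul_mem_geomTorsion_two W P⟩ : geomPoints W)) :
    h1Eval W (2 : ℤ) x ρ = 0 ↔ A = 0 ∨ A.comp (A.comp A) = AddMonoidHom.id _ := by
  classical
  have hT : torsionFixing W (4 : ℤ) ≤ torsionFixing W (2 : ℤ) :=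
    KolyvaginLowerBoundAtTwo.torsionFixing_le_of_dvd W (by norm_num)
  -- ### realisations `σ A` of the unipotents `u_A`, and the transfer of `[x, ·]` onto them
  choose σ hσ using fun B : geomTorsion W (2 : ℤ) →+ geomTorsion W (2 : ℤ) ↦
    exists_smul_eq_add_apply_two_zsmul W hsurj4 B
  have hσT : ∀ B, σ B ∈ torsionFixing W (2 : ℤ) := fun B ↦ mem_torsionFixing_two_of_smul_eq_add W B (hσ B)
  have transfer : ∀ (B : geomTorsion W (2 : ℤ) →+ geomTorsion W (2 : ℤ)) {τ : absoluteGaloisGroup ℚ},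
      (∀ P : geomTorsion W (4 : ℤ), ((τ • P : geomTorsion W (4 : ℤ)) : geomPoints W) =
        (P : geomPoints W) + (B ⟨(2 : ℤ) • (P : geomPoints W), two_zsmul_mem_geomTorsion_two W P⟩ : geomPoints W)) →
      h1Eval W (2 : ℤ) x τ = h1Eval W (2 : ℤ) x (σ B) := by
    intro B τ hτ
    have h4 : τ * (σ B)⁻¹ ∈ torsionFixing W (4 : ℤ) :=
      mul_inv_mem_torsionFixing_four_of_smul_eq_add W B (hσ B) hτ
    have e : τ = (τ * (σ B)⁻¹) * σ B := by group
    rw [e, h1Eval_mul W _ x (hT h4), hx _ h4, zero_add]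
  -- ### a frame `E[2] ≃ 𝔽₂²`; matrices ↦ endomorphisms of `E[2]`
  haveI : Fact (Nat.Prime 2) := ⟨Nat.prime_two⟩
  have h2T : ∀ P : geomTorsion W (2 : ℤ), 2 • P = 0 := fun P ↦ AddSubgroup.torsionBy.nsmul P
  have hcard : Nat.card (geomTorsion W (2 : ℤ)) = 2 ^ 2 := natCard_geomTorsion_two_rat W
  obtain ⟨e⟩ := KolyvaginImage.nonempty_addEquiv_of_card_eq_sq h2T hcard
  let endo : Matrix (Fin 2) (Fin 2) (ZMod 2) → (geomTorsion W (2 : ℤ) →+ geomTorsion W (2 : ℤ)) := fun M ↦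
    e.symm.toAddMonoidHom.comp ((Matrix.toLin' M).toAddMonoidHom.comp e.toAddMonoidHom)
  have hendo : ∀ (M : Matrix (Fin 2) (Fin 2) (ZMod 2)) (v : geomTorsion W (2 : ℤ)),
      endo M v = e.symm (M *ᵥ e v) := fun M v ↦ by
    simp [endo, Matrix.toLin'_apply]
  have endo_add : ∀ M N : Matrix (Fin 2) (Fin 2) (ZMod 2), endo (M + N) = endo M + endo N := fun M N ↦
    AddMonoidHom.ext fun v ↦ by rw [AddMonoidHom.add_apply, hendo, hendo, hendo, Matrix.add_mulVec, map_add]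
  have endo_mul : ∀ M N : Matrix (Fin 2) (Fin 2) (ZMod 2), endo (M * N) = (endo M).comp (endo N) := fun M N ↦
    AddMonoidHom.ext fun v ↦ by
      show endo (M * N) v = endo M (endo N v)
      rw [hendo, hendo, hendo, e.apply_symm_apply, Matrix.mulVec_mulVec]
  have endo_one : endo 1 = AddMonoidHom.id _ := AddMonoidHom.ext fun v ↦ by rw [hendo, Matrix.one_mulVec, e.symm_apply_apply, AddMonoidHom.id_apply]
  have endo_zero : endo 0 = 0 := AddMonoidHom.ext fun v ↦ by rw [hendo, Matrix.zero_mulVec, map_zero, AddMonoidHom.zero_apply]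
  have endo_inj : ∀ M N : Matrix (Fin 2) (Fin 2) (ZMod 2), endo M = endo N → M = N := by
    intro M N h
    refine Matrix.toLin'.injective (LinearMap.ext fun w ↦ ?_)
    rw [Matrix.toLin'_apply, Matrix.toLin'_apply]
    have h1 := DFunLike.congr_fun h (e.symm w)
    rw [hendo, hendo, e.apply_symm_apply] at h1
    exact e.symm.injective h1
  have endo_surj : ∀ B : geomTorsion W (2 : ℤ) →+ geomTorsion W (2 : ℤ), ∃ M, endo M = B := by
    intro B
    refine ⟨LinearMap.toMatrix' ((e.toAddMonoidHom.comp (B.comp e.symm.toAddMonoidHom)).toZModLinearMap 2), ?_⟩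
    refine AddMonoidHom.ext fun v ↦ ?_
    rw [hendo, ← Matrix.toLin'_apply, Matrix.toLin'_toMatrix']
    apply e.symm_apply_eq.mpr
    simp
  -- ### the additive map `F_x : M₂(𝔽₂) → 𝔽₂²`
  have addF : ∀ M N : Matrix (Fin 2) (Fin 2) (ZMod 2), e (h1Eval W (2 : ℤ) x (σ (endo (M + N)))) =
      e (h1Eval W (2 : ℤ) x (σ (endo M))) + e (h1Eval W (2 : ℤ) x (σ (endo N))) := by
    intro M N
    rw [← map_add, endo_add,
      ← transfer (endo M + endo N) (smul_eq_add_mul W (endo M) (endo N) (hσ _) (hσ _)),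
      h1Eval_mul W _ x (hσT _)]
  let F : Matrix (Fin 2) (Fin 2) (ZMod 2) →+ (Fin 2 → ZMod 2) :=
    AddMonoidHom.mk' (fun M ↦ e (h1Eval W (2 : ℤ) x (σ (endo M)))) addF
  have hF : ∀ M : Matrix (Fin 2) (Fin 2) (ZMod 2), F M = e (h1Eval W (2 : ℤ) x (σ (endo M))) := fun M ↦ rfl
  -- ### equivariance under `GL₂(𝔽₂)` (every automorphism of `E[2]` is Galois: `ρ̄_{W,2}` onto)
  have equiv : ∀ (g g' M : Matrix (Fin 2) (Fin 2) (ZMod 2)), g * g' = 1 → F (g * M * g') = g *ᵥ F M := by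
    intro g g' M hgg'
    have hg'g : g' * g = 1 := mul_eq_one_comm.mp hgg'
    let φ : geomTorsion W (2 : ℤ) ≃+ geomTorsion W (2 : ℤ) :=
      { toFun := fun v ↦ e.symm (g *ᵥ e v)
        invFun := fun v ↦ e.symm (g' *ᵥ e v)
        left_inv := fun v ↦ by
          show e.symm (g' *ᵥ e (e.symm (g *ᵥ e v))) = v
          rw [e.apply_symm_apply, Matrix.mulVec_mulVec, hg'g, Matrix.one_mulVec, e.symm_apply_apply]
        right_inv := fun v ↦ by
          show e.symm (g *ᵥ e (e.symm (g' *ᵥ e v))) = v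
          rw [e.apply_symm_apply, Matrix.mulVec_mulVec, hgg', Matrix.one_mulVec, e.symm_apply_apply]
        map_add' := fun v w ↦ by
          show e.symm (g *ᵥ e (v + w)) = e.symm (g *ᵥ e v) + e.symm (g *ᵥ e w)
          rw [map_add, Matrix.mulVec_add, map_add] }
    obtain ⟨τ, hτ⟩ := hsurj (Multiplicative.ofAdd φ)
    have hτv : ∀ v : geomTorsion W (2 : ℤ), τ • v = e.symm (g *ᵥ e v) := fun v ↦ by
      have h := galoisRepTorsion_apply W (2 : ℤ) τ v
      rw [hτ, toAdd_ofAdd] at h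
      exact h.symm
    have hτ'v : ∀ v : geomTorsion W (2 : ℤ), τ⁻¹ • v = e.symm (g' *ᵥ e v) := fun v ↦ by
      have h : τ • (e.symm (g' *ᵥ e v)) = v := by
        rw [hτv, e.apply_symm_apply, Matrix.mulVec_mulVec, hgg', Matrix.one_mulVec, e.symm_apply_apply]
      nth_rewrite 1 [← h]
      rw [inv_smul_smul]
    have hconj : endo (g * M * g') = (DistribSMul.toAddMonoidHom (geomTorsion W (2 : ℤ)) τ).comp
        ((endo M).comp (DistribSMul.toAddMonoidHom (geomTorsion W (2 : ℤ)) τ⁻¹)) :=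
      AddMonoidHom.ext fun v ↦ by
        show endo (g * M * g') v = τ • (endo M (τ⁻¹ • v))
        rw [hendo, hτ'v, hendo, e.apply_symm_apply, hτv, e.apply_symm_apply, Matrix.mulVec_mulVec,
          Matrix.mulVec_mulVec]
    rw [hF, hF, hconj, ← transfer _ (smul_eq_add_conj W (endo M) (hσ (endo M)) τ),
      h1Eval_conj W _ x τ (hσT _), hτv, e.apply_symm_apply]
  -- ### non-vanishing (Prop. 9.1 at `2`: a non-zero class does not die on `Γ_{ℚ(E[2])}`)
  have nonzero : F ≠ 0 := by
    intro hF0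
    apply hx0
    apply h1_restriction_injective_two_rat W hsurj
    intro τ hτ
    obtain ⟨B, hB⟩ := exists_smul_eq_add_of_mem_torsionFixing_two W hτ
    obtain ⟨M, hM⟩ := endo_surj B
    have h := DFunLike.congr_fun hF0 M
    rw [AddMonoidHom.zero_apply, hF M, hM, ← transfer B hB] at h
    exact (map_eq_zero_iff e e.injective).mp h
  -- ### read the value at `ρ` through `F`
  obtain ⟨M, hM⟩ := endo_surj A
  have hval : h1Eval W (2 : ℤ) x ρ = 0 ↔ F M = 0 := by
    rw [hF M, hM, ← transfer A hρ, map_eq_zero_iff e e.injective]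
  rw [hval, twoByTwo_equivariant_apply_eq_zero_iff F equiv nonzero M, ← hM]
  constructor
  · rintro (h | h)
    · left; rw [h, endo_zero]
    · right; rw [← endo_mul, ← endo_mul, ← mul_assoc, h, endo_one]
  · rintro (h | h)
    · left; exact endo_inj _ _ (by rw [h, endo_zero])
    · right; exact endo_inj _ _ (by rw [mul_assoc, endo_mul, endo_mul, h, endo_one])

/-- **`[x, ρ] = 0` for `ρ` acting as `−1` on `E[4]`** (datum `A = 1`, which lies in `𝔽₄`): the level-`4` class vanishes at the central
element. [cite: LawsonWuthrich2016, §3] -/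
theorem h1Eval_eq_zero_of_smul_eq_neg [W.IsElliptic] (hsurj : W.HasSurjectiveModNGaloisRep 2)
    (hsurj4 : W.HasSurjectiveModNGaloisRep 4) {x : galH1Torsion W (2 : ℤ)} (hx0 : x ≠ 0)
    (hx : ∀ h ∈ torsionFixing W (4 : ℤ), h1Eval W (2 : ℤ) x h = 0)
    {ρ : absoluteGaloisGroup ℚ} (hρ : ∀ P : geomTorsion W (4 : ℤ), ρ • P = -P) :
    h1Eval W (2 : ℤ) x ρ = 0 := by
  have hρ' : ∀ P : geomTorsion W (4 : ℤ), ((ρ • P : geomTorsion W (4 : ℤ)) : geomPoints W) =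
      (P : geomPoints W) + ((AddMonoidHom.id _ : geomTorsion W (2 : ℤ) →+ geomTorsion W (2 : ℤ))
        ⟨(2 : ℤ) • (P : geomPoints W), two_zsmul_mem_geomTorsion_two W P⟩ : geomPoints W) := by
    intro P
    rw [hρ P, AddMonoidHom.id_apply, AddSubgroup.coe_neg]
    change -(P : geomPoints W) = (P : geomPoints W) + (2 : ℤ) • (P : geomPoints W)
    have h4 : (4 : ℤ) • (P : geomPoints W) = 0 := (WeierstrassCurve.mem_geomTorsion_iff W (4 : ℤ) _).mp P.2
    have : (P : geomPoints W) + (2 : ℤ) • (P : geomPoints W) + (P : geomPoints W) = (4 : ℤ) • (P : geomPoints W) := by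
      module
    rw [eq_comm, ← sub_eq_zero, sub_neg_eq_add, this, h4]
  rw [h1Eval_eq_zero_iff_of_smul_eq_add W hsurj hsurj4 hx0 hx hρ']
  right
  exact AddMonoidHom.ext fun _ ↦ rfl

end Values

/-! ## §54c The basis-free strictness criterion at a transposition-type element -/

section Criterion

variable (W : WeierstrassCurve ℚ) [W.IsElliptic]

/-- **`[ξ_W, σ]` IS A COBOUNDARY VALUE ⟺ `σ² = ±1` ON `E[4]`.** `W/ℚ` elliptic with `ρ̄_{W,2}`, `ρ_{W,4}` onto; `x ≠ 0` dying on
`Γ_{ℚ(E[4])}`; `σ ∈ Γ_ℚ` with `σ² ∈ Γ_{ℚ(E[2])}` and `σ ≠ 1` on `E[2]` (a transposition on `E[2]`). Then `∃ m, [x, σ] = σm − m` iff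
`σ²` fixes `E[4]` or `σ²` is `−1` on `E[4]`. (§52a: ⟺ `[x, σ²] = 0`; §54b: ⟺ the datum `A` of `σ²` lies in `𝔽₄`; and `A` commutes with
the transposition `σ̄` because `σ` centralises `σ²`, which by §54a leaves `A ∈ {0, 1}`.) With §52b: at a good prime `ℓ₀` whose Frobenius
is a transposition on `E[2]`, the level-`4` class is strict iff `Frob_{ℓ₀}² = ±1` on `E[4]`.
[cite: LawsonWuthrich2016, §3] [cite: GrossLMS1991, §9 Prop. 9.6] -/
theorem exists_h1Eval_eq_smul_sub_iff_sq_smul (hsurj : W.HasSurjectiveModNGaloisRep 2)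
    (hsurj4 : W.HasSurjectiveModNGaloisRep 4) {x : galH1Torsion W (2 : ℤ)} (hx0 : x ≠ 0)
    (hx : ∀ h ∈ torsionFixing W (4 : ℤ), h1Eval W (2 : ℤ) x h = 0)
    {σ : absoluteGaloisGroup ℚ} (hσσ : σ * σ ∈ torsionFixing W (2 : ℤ)) (hσ : ∃ T : geomTorsion W (2 : ℤ), σ • T ≠ T) :
    (∃ m : geomTorsion W (2 : ℤ), h1Eval W (2 : ℤ) x σ = σ • m - m) ↔
      ((∀ P : geomTorsion W (4 : ℤ), (σ * σ) • P = P) ∨ (∀ P : geomTorsion W (4 : ℤ), (σ * σ) • P = -P)) := by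
  classical
  have hσσ' : ∀ T : geomTorsion W (2 : ℤ), σ • σ • T = T := fun T ↦ by
    rw [← mul_smul]; exact smul_eq_of_mem_torsionFixing W (2 : ℤ) hσσ T
  rw [exists_h1Eval_eq_smul_sub_iff_h1Eval_mul_self_eq_zero W x hσσ' hσ]
  -- the datum `A` of `σ²`
  obtain ⟨A, hA⟩ := exists_smul_eq_add_of_mem_torsionFixing_two W hσσ
  rw [h1Eval_eq_zero_iff_of_smul_eq_add W hsurj hsurj4 hx0 hx hA]
  -- reading the datum: `A(2P) = σ²P − P`
  have h24 : geomTorsion W (2 : ℤ) ≤ geomTorsion W (4 : ℤ) := W.geomTorsion_le_of_dvd (by norm_num)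
  have hAval : ∀ P : geomTorsion W (4 : ℤ),
      ((A ⟨(2 : ℤ) • (P : geomPoints W), two_zsmul_mem_geomTorsion_two W P⟩ : geomTorsion W (2 : ℤ)) : geomPoints W) =
        (((σ * σ) • P : geomTorsion W (4 : ℤ)) : geomPoints W) - (P : geomPoints W) := fun P ↦ by
    rw [hA P, add_sub_cancel_left]
  -- every `v ∈ E[2]` is `2P` for some `P ∈ E[4]`
  have hdiv := W.zsmul_geomPoints_surjective_of_charZero (n := (2 : ℤ)) two_ne_zero
  have hhalf : ∀ v : geomTorsion W (2 : ℤ), ∃ P : geomTorsion W (4 : ℤ), (2 : ℤ) • (P : geomPoints W) = v := by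
    intro v
    obtain ⟨Q, hQ⟩ := hdiv (v : geomPoints W)
    have hQ' : (2 : ℤ) • Q = (v : geomPoints W) := hQ
    have hQ4 : Q ∈ geomTorsion W (4 : ℤ) := by
      rw [WeierstrassCurve.mem_geomTorsion_iff, show (4 : ℤ) = 2 * 2 by norm_num, mul_smul, hQ']
      exact (WeierstrassCurve.mem_geomTorsion_iff W (2 : ℤ) _).mp v.2
    exact ⟨⟨Q, hQ4⟩, hQ'⟩
  constructor
  · rintro (hA0 | hA3)
    · -- `A = 0`: `σ²` fixes `E[4]`
      left
      intro P
      apply Subtype.ext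
      have h := hAval P
      rw [hA0, AddMonoidHom.zero_apply, AddSubgroup.coe_zero] at h
      exact (sub_eq_zero.mp h.symm)
    · -- `A³ = 1`: `A` commutes with the transposition `σ̄`, so `A = 1`, i.e. `σ² = −1` on `E[4]`
      right
      -- `A` commutes with `σ̄`: `σ̄ A σ̄⁻¹` is the datum of `σ σ² σ⁻¹ = σ²`
      have hconjA : ∀ v : geomTorsion W (2 : ℤ), σ • A (σ⁻¹ • v) = A v := by
        intro v
        obtain ⟨P, hP⟩ := hhalf (σ⁻¹ • v)
        -- datum of the conjugate at `σ • P`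
        have h1 := smul_eq_add_conj W A hA σ (σ • P)
        have heq : σ * (σ * σ) * σ⁻¹ = σ * σ := by group
        rw [heq, hA (σ • P)] at h1
        have h2 := add_left_cancel h1
        -- `h2 : A ⟨2 • σP⟩ = σ A σ⁻¹ ⟨2 • σP⟩` as points
        have hv : (⟨(2 : ℤ) • ((σ • P : geomTorsion W (4 : ℤ)) : geomPoints W), two_zsmul_mem_geomTorsion_two W (σ • P)⟩ :
            geomTorsion W (2 : ℤ)) = v := by
          apply Subtype.ext
          change (2 : ℤ) • (σ • (P : geomPoints W)) = (v : geomPoints W)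
          rw [← WeierstrassCurve.smul_zsmul_geomPoints, hP]
          change ((σ • (σ⁻¹ • v) : geomTorsion W (2 : ℤ)) : geomPoints W) = v
          rw [smul_inv_smul]
        rw [hv] at h2
        exact (Subtype.ext (by rw [h2]; rfl) : A v = σ • A (σ⁻¹ • v)).symm
      -- in the frame: matrices `M` of `A` and `S` of `σ̄`
      haveI : Fact (Nat.Prime 2) := ⟨Nat.prime_two⟩
      have h2T : ∀ P : geomTorsion W (2 : ℤ), 2 • P = 0 := fun P ↦ AddSubgroup.torsionBy.nsmul P
      have hcard : Nat.card (geomTorsion W (2 : ℤ)) = 2 ^ 2 := natCard_geomTorsion_two_rat W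
      obtain ⟨e⟩ := KolyvaginImage.nonempty_addEquiv_of_card_eq_sq h2T hcard
      obtain ⟨S, hS⟩ : ∃ S : Matrix (Fin 2) (Fin 2) (ZMod 2), ∀ T : geomTorsion W (2 : ℤ), e (σ • T) = S *ᵥ e T := by
        refine ⟨LinearMap.toMatrix' ((e.toAddMonoidHom.comp
          ((DistribSMul.toAddMonoidHom (geomTorsion W (2 : ℤ)) σ).comp e.symm.toAddMonoidHom)).toZModLinearMap 2),
          fun T ↦ ?_⟩
        rw [← Matrix.toLin'_apply, Matrix.toLin'_toMatrix']
        simp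
      obtain ⟨M, hM⟩ : ∃ M : Matrix (Fin 2) (Fin 2) (ZMod 2), ∀ T : geomTorsion W (2 : ℤ), e (A T) = M *ᵥ e T := by
        refine ⟨LinearMap.toMatrix' ((e.toAddMonoidHom.comp (A.comp e.symm.toAddMonoidHom)).toZModLinearMap 2), fun T ↦ ?_⟩
        rw [← Matrix.toLin'_apply, Matrix.toLin'_toMatrix']
        simp
      have toMat_inj : ∀ X Y : Matrix (Fin 2) (Fin 2) (ZMod 2), (∀ w, X *ᵥ w = Y *ᵥ w) → X = Y := fun X Y h ↦
        Matrix.toLin'.injective (LinearMap.ext fun w ↦ by rw [Matrix.toLin'_apply, Matrix.toLin'_apply, h w])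
      have hSS : S * S = 1 := toMat_inj _ _ fun w ↦ by
        rw [← Matrix.mulVec_mulVec, Matrix.one_mulVec]
        have h := hS (σ • e.symm w)
        rw [hσσ', e.apply_symm_apply, hS, e.apply_symm_apply] at h
        exact h.symm
      have hS1 : S ≠ 1 := by
        obtain ⟨T, hT⟩ := hσ
        intro hS1
        apply hT
        apply e.injective
        rw [hS, hS1, Matrix.one_mulVec]
      have hMMM : M * M * M = 1 := toMat_inj _ _ fun w ↦ by
        rw [← Matrix.mulVec_mulVec, ← Matrix.mulVec_mulVec, Matrix.one_mulVec]
        have h := DFunLike.congr_fun hA3 (e.symm w)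
        rw [AddMonoidHom.comp_apply, AddMonoidHom.comp_apply, AddMonoidHom.id_apply] at h
        have h' := congrArg e h
        rw [hM, hM, hM, e.apply_symm_apply] at h'
        exact h'
      have hSM : S * M = M * S := toMat_inj _ _ fun w ↦ by
        rw [← Matrix.mulVec_mulVec, ← Matrix.mulVec_mulVec]
        -- `S M S⁻¹ = M` from `hconjA`, and `S⁻¹ = S`
        have h := congrArg e (hconjA (σ • e.symm w))
        rw [inv_smul_smul, hS, hM, hM, hS, e.apply_symm_apply] at h
        exact h
      have hM1 : M = 1 := twoByTwo_eq_one_of_cube_of_commute M S hMMM hSS hS1 hSM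
      -- hence `A = id` and `σ² = −1` on `E[4]`
      have hAid : ∀ v : geomTorsion W (2 : ℤ), A v = v := fun v ↦
        e.injective (by rw [hM, hM1, Matrix.one_mulVec])
      intro P
      apply Subtype.ext
      have h := hAval P
      rw [hAid] at h
      -- `2P = σ²P − P` ⟹ `σ²P = 3P = −P`
      change (2 : ℤ) • (P : geomPoints W) = _ at h
      rw [AddSubgroup.coe_neg]
      have h4 : (4 : ℤ) • (P : geomPoints W) = 0 := (WeierstrassCurve.mem_geomTorsion_iff W (4 : ℤ) _).mp P.2
      have e3 : (((σ * σ) • P : geomTorsion W (4 : ℤ)) : geomPoints W) = (2 : ℤ) • (P : geomPoints W) + (P : geomPoints W) := by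
        rw [h, sub_add_cancel]
      rw [e3]
      have : (2 : ℤ) • (P : geomPoints W) + (P : geomPoints W) + (P : geomPoints W) = (4 : ℤ) • (P : geomPoints W) := by module
      rw [eq_neg_iff_add_eq_zero, this, h4]
  · rintro (h1 | hneg)
    · left
      apply AddMonoidHom.ext
      intro v
      obtain ⟨P, hP⟩ := hhalf v
      have hv : (⟨(2 : ℤ) • (P : geomPoints W), two_zsmul_mem_geomTorsion_two W P⟩ : geomTorsion W (2 : ℤ)) = v :=
        Subtype.ext hP
      have h := hAval P
      rw [hv, h1 P, sub_self] at h
      exact Subtype.ext h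
    · right
      apply AddMonoidHom.ext
      intro v
      obtain ⟨P, hP⟩ := hhalf v
      have hv : (⟨(2 : ℤ) • (P : geomPoints W), two_zsmul_mem_geomTorsion_two W P⟩ : geomTorsion W (2 : ℤ)) = v :=
        Subtype.ext hP
      have h := hAval P
      rw [hv, hneg P, AddSubgroup.coe_neg] at h
      -- `A v = −P − P = −2P = -v = v`… as `2`-torsion: `A v = v`
      rw [AddMonoidHom.comp_apply, AddMonoidHom.comp_apply, AddMonoidHom.id_apply]
      have hAv : A v = v := by
        apply Subtype.ext
        rw [h, ← hP]
        have h4 : (4 : ℤ) • (P : geomPoints W) = 0 := (WeierstrassCurve.mem_geomTorsion_iff W (4 : ℤ) _).mp P.2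
        have : -(P : geomPoints W) - (P : geomPoints W) = (2 : ℤ) • (P : geomPoints W) - (4 : ℤ) • (P : geomPoints W) := by
          module
        rw [this, h4, sub_zero]
      rw [hAv, hAv, hAv]

end Criterion

end Summit.BirchSwinnertonDyer.BirchSwinnertonDyer.Theorems.GenusKolyTwistingPrime

end
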